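import Summits.Langlands.Langlands.Theorems.CoreAdequacySplitNoAdequateLayerLiftingStubCoprimeTableLiftingBridge
import Literature.GroupTheory.SpecificGroups.PGL2SylowCharP
import Literature.NumberTheory.GaloisRepresentations.ProjectiveType

/-!
# RSL `CoreAdequacySplit.NoAdequateLayerLifting` (stmt-Langlands-27954), line `birth`, stub 3/3 `stub_coprimeTableLifting` — STRUCTURAL HELPERS, part 3a:
# the RANK-TWO ROWS satisfy the hypotheses of Dickson's `p`-irregular classification

Part 1 reduced the TABLE stub to ROW(2,5) ∧ ROWS(n ≥ 3); part 2 proved that on every coprime row the residual image `I = τ(Γ_{K(ζ_ℓ)})` has order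
divisible by `ℓ`.  This file prepares the rank-two rows for the landed DICKSON CLASSIFICATION of the finite `p`-irregular subgroups of `PGL₂(k̄)`
(`Literature.GroupTheory.SpecificGroups.PGL2.exists_smul_eq_or_exists_conj_eq_of_five_le`, Faber 2011 Thm. B after Dickson 1901 — applied in part 3b,
`…RankTwo.lean`): for `n = 2`, `ℓ` odd and an RSL instance (¬SADQ) with absolutely irreducible reduction `τ` over `K(ζ_ℓ)`, the PROJECTIVE IMAGE
`H = image of I in PGL₂(𝔽̄_ℓ)` (tree `projectiveImage τ`) is FINITE, has ORDER DIVISIBLE BY `ℓ` (an element of order `ℓ` of `I` — Cauchy — is not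
central: central elements of `ℓ`-power order are trivial in characteristic `ℓ`), and FIXES NO POINT of `ℙ¹(𝔽̄_ℓ)` (a common fixed point of `H` is a
common eigenline of `I`, contradicting absolute irreducibility) — `rank_two_row_dickson_hypotheses`.  So Dickson's theorem leaves exactly: `H` is
conjugate to `PSL₂(𝔽_q)` or `PGL₂(𝔽_q)`, `𝔽_q ≤ 𝔽̄_ℓ` finite (part 3b).  No new definition; 0 sorry.
-/

set_option linter.dupNamespace false

namespace Summit.Langlands.Langlands.Theorems.CoreAdequacy.CoprimeTable

open scoped MatrixGroups Pointwise Matrix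
open Literature.NumberTheory.GaloisRepresentations
open Literature.GroupTheory.SpecificGroups
open Summit.Langlands.Langlands.Theses

universe u

section RankTwoGroup

variable {k : Type u} [Field k]

/-- In characteristic `ℓ` a central element of `GL₂(k)` with `g ^ ℓ = 1` is trivial (a scalar `a` with `a^ℓ = 1` has `(a − 1)^ℓ = 0`). -/
theorem eq_one_of_mem_center_of_pow_eq_one {ℓ : ℕ} [Fact ℓ.Prime] [CharP k ℓ] {g : GL (Fin 2) k}
    (hg : g ∈ Subgroup.center (GL (Fin 2) k)) (hpow : g ^ ℓ = 1) : g = 1 := by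
  obtain ⟨a, ha⟩ := Matrix.GeneralLinearGroup.mem_center_iff_val_mem_range_scalar.1 hg
  have hval : ((g ^ ℓ : GL (Fin 2) k) : Matrix (Fin 2) (Fin 2) k) = 1 := by rw [hpow, Units.val_one]
  rw [Units.val_pow_eq_pow_val, ← ha, ← map_pow, ← map_one (Matrix.scalar (Fin 2))] at hval
  have hal : a ^ ℓ = 1 := Matrix.scalar_inj.1 hval
  have ha1 : a = 1 := by
    have h0 : (a - 1) ^ ℓ = 0 := by rw [sub_pow_char, hal, one_pow, sub_self]
    exact sub_eq_zero.1 ((pow_eq_zero_iff (Fact.out : ℓ.Prime).ne_zero).1 h0)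
  apply Units.ext
  rw [← ha, ha1, map_one, Units.val_one]

/-- **The image in `PGL₂` of a finite `I ≤ GL₂(k)` with `ℓ ∣ |I|` has order divisible by `ℓ`** (`char k = ℓ`): an element of order `ℓ` of `I`
(Cauchy) maps to an element of order `ℓ` (it is not central). -/
theorem dvd_card_map_mk_of_dvd_card {ℓ : ℕ} [Fact ℓ.Prime] [CharP k ℓ] (I : Subgroup (GL (Fin 2) k)) [Finite I]
    [Finite (I.map (Matrix.ProjGenLinGroup.mk (n := Fin 2) (R := k)))] (hdvd : ℓ ∣ Nat.card I) :
    ℓ ∣ Nat.card (I.map (Matrix.ProjGenLinGroup.mk (n := Fin 2) (R := k))) := by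
  obtain ⟨g, hg⟩ := exists_prime_orderOf_dvd_card' ℓ hdvd
  have hgI : Matrix.ProjGenLinGroup.mk (g : GL (Fin 2) k) ∈ I.map Matrix.ProjGenLinGroup.mk := Subgroup.mem_map_of_mem _ g.2
  have hg' : orderOf (g : GL (Fin 2) k) = ℓ := by rw [Subgroup.orderOf_coe, hg]
  have hord : orderOf (⟨Matrix.ProjGenLinGroup.mk (g : GL (Fin 2) k), hgI⟩ : I.map Matrix.ProjGenLinGroup.mk) = ℓ := by
    rw [Subgroup.orderOf_mk]
    have hdvd' : orderOf (Matrix.ProjGenLinGroup.mk (g : GL (Fin 2) k)) ∣ ℓ := by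
      rw [← hg']
      exact orderOf_map_dvd _ _
    rcases (Nat.dvd_prime (Fact.out : ℓ.Prime)).1 hdvd' with h1 | hℓ
    · exfalso
      have hone : Matrix.ProjGenLinGroup.mk (g : GL (Fin 2) k) = 1 := orderOf_eq_one_iff.1 h1
      have hcen := Matrix.ProjGenLinGroup.mk_eq_one.1 hone
      have hpow : (g : GL (Fin 2) k) ^ ℓ = 1 := by rw [← hg']; exact pow_orderOf_eq_one _
      have hg1 : (g : GL (Fin 2) k) = 1 := eq_one_of_mem_center_of_pow_eq_one hcen hpow
      have h11 : orderOf (g : GL (Fin 2) k) = 1 := by rw [hg1, orderOf_one]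
      rw [hg'] at h11
      exact (Fact.out : ℓ.Prime).one_lt.ne' h11
    · exact hℓ
  rw [← hord]
  exact orderOf_dvd_natCard _

/-- The projective image of a homomorphism with finite image is finite. -/
theorem finite_projectiveImage {G : Type*} [Group G] (τ : G →* GL (Fin 2) k) [Finite τ.range] : Finite (projectiveImage τ) := by
  rw [projectiveImage_eq_map_range]
  exact Finite.of_surjective _ (MonoidHom.subgroupMap_surjective _ τ.range)

/-- **`ℓ ∣ |projective image|`** for `τ : G → GL₂(k)` with finite image of order divisible by `ℓ = char k`. -/
theorem dvd_card_projectiveImage {ℓ : ℕ} [Fact ℓ.Prime] [CharP k ℓ] {G : Type*} [Group G] (τ : G →* GL (Fin 2) k) [Finite τ.range]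
    [Finite (projectiveImage τ)] (hdvd : ℓ ∣ Nat.card τ.range) : ℓ ∣ Nat.card (projectiveImage τ) := by
  haveI : Finite (τ.range.map (Matrix.ProjGenLinGroup.mk (n := Fin 2) (R := k))) := by
    rw [← projectiveImage_eq_map_range]; infer_instance
  have h := dvd_card_map_mk_of_dvd_card τ.range hdvd
  rwa [← projectiveImage_eq_map_range] at h

/-- **An absolutely irreducible `τ : G → GL₂(k)` has no common eigenline**: if some `v ≠ 0` is an eigenvector of every `τ(g)` then the line `k · v`
is a proper non-zero `τ`-stable submodule, contradicting irreducibility over `k` (`f = id` in `IsAbsIrreducible`). -/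
theorem false_of_forall_mulVec_eq_smul {G : Type*} [Group G] {τ : G →* GL (Fin 2) k} (hirr : IsAbsIrreducible τ) {v : Fin 2 → k}
    (hv : v ≠ 0) (heig : ∀ g : G, ∃ a : k, ((τ g : GL (Fin 2) k) : Matrix (Fin 2) (Fin 2) k) *ᵥ v = a • v) : False := by
  -- `τ` is irreducible over `k` itself
  have hirr' : (glRepresentation τ).IsIrreducible := by
    have h1 := hirr k (RingHom.id k)
    have e : (Matrix.GeneralLinearGroup.map (n := Fin 2) (RingHom.id k)).comp τ = τ := by
      refine MonoidHom.ext fun g => Units.ext ?_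
      ext i j
      simp
    rwa [e] at h1
  -- the line `k · v` as a subrepresentation
  let W : Subrepresentation (glRepresentation τ) :=
    { toSubmodule := k ∙ v
      apply_mem_toSubmodule := fun g w hw => by
        obtain ⟨c, rfl⟩ := Submodule.mem_span_singleton.1 hw
        obtain ⟨a, ha⟩ := heig g
        refine Submodule.mem_span_singleton.2 ⟨c * a, ?_⟩
        rw [glRepresentation_apply_apply, Matrix.mulVec_smul, ha, smul_smul] }
  have hWsub : W.toSubmodule = k ∙ v := rfl
  haveI : (glRepresentation τ).IsIrreducible := hirr'
  rcases IsSimpleOrder.eq_bot_or_eq_top W with hbot | htop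
  · have h0 : (k ∙ v : Submodule k (Fin 2 → k)) = ⊥ := by rw [← hWsub, hbot]; rfl
    exact hv (Submodule.span_singleton_eq_bot.1 h0)
  · have h1 : (k ∙ v : Submodule k (Fin 2 → k)) = ⊤ := by rw [← hWsub, htop]; rfl
    have h2 : Module.finrank k (k ∙ v) = 1 := finrank_span_singleton hv
    rw [h1, finrank_top, Module.finrank_fin_fun] at h2
    exact absurd h2 (by norm_num)

/-- **The projective image of an absolutely irreducible `τ : G → GL₂(k)` fixes no point of `ℙ¹(k)`** (Möbius action of the tree's
`PGL2.mulActionOnePoint`): a common fixed point is a common eigenline. -/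
theorem not_exists_forall_smul_eq_of_isAbsIrreducible [DecidableEq k] {G : Type*} [Group G] {τ : G →* GL (Fin 2) k} (hirr : IsAbsIrreducible τ) :
    ¬ ∃ x : OnePoint k, ∀ h ∈ projectiveImage τ, h • x = x := by
  rintro ⟨x, hx⟩
  set P := OnePoint.equivProjectivization k x with hP
  have hxv : x = (OnePoint.equivProjectivization k).symm (Projectivization.mk k P.rep P.rep_nonzero) := by
    rw [Projectivization.mk_rep, hP, Equiv.symm_apply_apply]
  refine false_of_forall_mulVec_eq_smul hirr P.rep_nonzero fun g => ?_
  have hmem : Matrix.ProjGenLinGroup.mk (τ g) ∈ projectiveImage τ := ⟨g, rfl⟩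
  have hfix := hx _ hmem
  rw [PGL2.mk_smul, hxv] at hfix
  exact (PGL2.smul_symm_mk_eq_iff (τ g) P.rep_nonzero).1 hfix

end RankTwoGroup

/-! ## The rank-two rows of the residual table satisfy Dickson's hypotheses -/

section Table

variable {K : Type} [Field K] [NumberField K] {ℓ : ℕ} [Fact ℓ.Prime]

/-- **RANK-TWO ROWS: the projective image is a finite `ℓ`-IRREGULAR subgroup of `PGL₂(𝔽̄_ℓ)` fixing no point of `ℙ¹`.**  For `ℓ` odd (so `ℓ ∤ 2`),
a rank-two `ρ` with NO adequate layer (¬SADQ) and an absolutely irreducible reduction `τ` of `ρ|Γ_{K(ζ_ℓ)}`: `projectiveImage τ` is finite, of order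
divisible by `ℓ`, and has no common fixed point on `ℙ¹(𝔽̄_ℓ)` — exactly the input of Dickson's classification (part 3b concludes: conjugate to
`PSL₂(𝔽_q)` or `PGL₂(𝔽_q)` when `ℓ ≥ 5`; in the TABLE, `ℓ = 5`). -/
theorem rank_two_row_dickson_hypotheses [DecidableEq (padicAlgClResidueField ℓ)] (hℓ2 : ¬ ℓ ∣ 2) {ρ : FramedGaloisRep K (PadicAlgCl ℓ) 2}
    (hN : ¬ SolvablyAdequateImage ρ) {τ : Field.absoluteGaloisGroup (CyclotomicField ℓ K) →* GL (Fin 2) (padicAlgClResidueField ℓ)}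
    (hτ : (ρ.restrictField (CyclotomicField ℓ K)).IsReductionOf (RingHom.id _) τ) (hirr : IsAbsIrreducible τ) :
    ∃ _ : Finite (projectiveImage τ), ℓ ∣ Nat.card (projectiveImage τ) ∧
      ¬ ∃ x : OnePoint (padicAlgClResidueField ℓ), ∀ h ∈ projectiveImage τ, h • x = x := by
  haveI := charP_padicAlgClResidueField ℓ
  haveI : Finite τ.range := finite_range_of_isReductionOf hτ
  haveI : Finite (projectiveImage τ) := finite_projectiveImage τ
  exact ⟨inferInstance, dvd_card_projectiveImage τ (dvd_card_image_of_coprime_row hℓ2 hN hτ hirr),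
    not_exists_forall_smul_eq_of_isAbsIrreducible hirr⟩

end Table

end Summit.Langlands.Langlands.Theorems.CoreAdequacy.CoprimeTable
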